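import Literature.Computability.AlgebraicComplexity.MS21IndependentMapLemmas
import HarnessLib

/-!
# Medini–Shpilka 2021, §3: the `1`-independence engines POINTWISE and block-free
# (PRINT-ERRATA B34, repair step 2: Lemmas 3.9 / 3.10 for maps independent RELATIVE to a coordinate set)

Theorem-only support file (cell `val-lit`, seat p1 g5) for the `MS2021_thm_35` programme (x5 g3)
and the B34 repair (cell memo `np/p1g5-B34-repair-memo.md`; step 1 = `MS21InertHomogenization.lean`).
Source: [MediniShpilka2021] CCC 2021 = arXiv:2102.05632, §3, Lemma 3.9 (‹lem:indDerivLinear›,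
p0017:L67–p0018:L12) and Lemma 3.10 (‹lem:indProjectZero›, p0018:L14–L34), Def 19 (p0006:L64–L65).

The toolkit `MS21IndependentMapLemmas.lean` (seat t24 g5) states both lemmas for a `1`-independent
block `G_1` (Def 19: an isolating assignment for EVERY coordinate). Their printed proofs — and
t24's kernel proofs — use the assignment at ONE coordinate only: the coordinate `i` being
differentiated (3.9) or shifted (3.10). This file records that observation as theorems, in a form
that mentions no block structure at all, so that they apply verbatim to maps that are independent
only RELATIVE to a set of coordinates — in particular to the INERT extension `G⁺ = (G, u^e)` of the
B34 repair, whose extra coordinate no block reaches and none needs to: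

* CORE (any family `R : [n] → K[W]` and a variable `z_0` occurring in no `R_j`):
  `(∂_i f) ∘ R ≠ 0 ⇒ f ∘ (R + z_0 e_i) ≠ 0` (`MS2021.bind₁_add_X_ne_zero_of_pderiv`: first-order
  Taylor expansion `f(R + z_0 e_i) = f(R) + z_0 (∂_i f)(R) + z_0² T` and two evaluations at
  `z_0 = 0` — "`∂g/∂z_1 |_{z_1=0} = (∂f/∂x_1) ∘ H ≠ 0`", p0018:L8–L12) and
  `f(x + L(x) e_i) ∘ R ≠ 0 ⇒ f ∘ (R + z_0 e_i) ≠ 0` (`MS2021.bind₁_add_X_ne_zero_of_shift`: substitute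
  `z_0 := L(R)` — "and therefore `f(x + G_1(y_1, z_1)) ∘ G_t ≠ 0`", p0035:L1); directional form
  `MS2021.bind₁_add_X_ne_zero_of_dirDeriv` (some `i` with `v_i ≠ 0`, "there exists some `i ∈ [n]`
  such that `∂f/∂x_i ∘ H ≠ 0`", p0018:L5).
* SUBSTITUTION PRINCIPLE: `f ∘ (ψ ∘ G) ≠ 0 ⇒ f ∘ G ≠ 0` for any algebra map `ψ`
  (`MS2021.bind₁_ne_zero_of_bind₁_comp_ne_zero`).
* POINTWISE SPECIALISATION: from the Def-19 clause of a block `G_1` at ONE coordinate `i`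
  (`∃ a, ∀ j, G_1,j(a, z) = δ_{ij} z`) and ANY embedding `ι` of the block's variables with the rest
  `R` free of them, the algebra map "controls `:= a`, everything else fixed" turns
  `rename ι ∘ G_1 + R` into `R + z_0 e_i` (`MS2021.aeval_extend_rename_add_eq`), whence the pointwise
  Lemmas 3.9 / 3.10 in this generality (`MS2021.bind₁_rename_add_ne_zero_of_pderiv/_of_dirDeriv/_of_shift`)
  and, as one-line corollaries, t24's sum-layout statements with the weakened hypothesis
  (`MS2021.bind₁_sum_ne_zero_of_pderiv_pointwise`, `…_of_dirDeriv_pointwise`, `…_of_shift_pointwise`).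
* INERT LAYOUT (B34): for the inert extension `G⁺ = Fin.lastCases (u^e) (rename inl ∘ G)` of a
  peeled map `G = G_1 + G'` (t24's `isIndependent_succ_iff` shape), peeling block `0` reduces
  `h ∘ G⁺ ≠ 0` to `(∂_{castSucc i} h) ∘ G'⁺ ≠ 0`, resp. `(∂_v h) ∘ G'⁺ ≠ 0` (`supp v ⊆ castSucc`),
  resp. `h(x̃ + L e_{castSucc i}) ∘ G'⁺ ≠ 0`, where `G'⁺` is the inert extension of `G'` — SAME
  shape, one block fewer, so the printed inductions iterate inside the layout
  (`MS2021.bind₁_inert_ne_zero_of_pderiv/_of_dirDeriv/_of_shift`). No block ever needs to reach the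
  coordinate `Fin.last n`.

No definitions, no facts. HONEST FRAMING: plumbing for a literature discharge; `VP ≠ VNP` is NOT
proved and nothing here bears on it.

## References
* [MediniShpilka2021] D. Medini, A. Shpilka, CCC 2021 (LIPIcs 200:19) = arXiv:2102.05632, §3:
  Def 19 (p0006:L64-L65), Lemma 3.9 and proof (p0017:L67-p0018:L12), Lemma 3.10 and proof
  (p0018:L14-L34), proof of Thm 43 Case 2 (p0035:L1).
-/

noncomputable section

open MvPolynomial

namespace Literature.Computability.AlgebraicComplexity

namespace MS2021

/-! ### Core: first-order Taylor expansion and the two substitutions, block-free -/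

section Core

variable {K : Type*} [Field K] {n : ℕ} {W : Type*}

/-- **First-order Taylor expansion in one coordinate**: `q(H + z·e_j) = q(H) + z·(∂_j q)(H) + z²·T`
over any commutative `K`-algebra ("`∂g/∂z_1 = 1 · (∂f/∂x_1)(z_1 + H_1, H_2, …, H_n)`").
[cite: MediniShpilka2021, proof of Lemma 3.9 (arXiv p0018:L6-L10)] -/
theorem exists_aeval_add_ite_eq {A : Type*} [CommRing A] [Algebra K A]
    (H : Fin n → A) (z : A) (j : Fin n) (q : MvPolynomial (Fin n) K) :
    ∃ T : A, aeval (fun i => H i + if i = j then z else 0) q =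
      aeval H q + z * aeval H (pderiv j q) + z ^ 2 * T := by
  classical
  induction q using MvPolynomial.induction_on with
  | C a => exact ⟨0, by simp⟩
  | add p q hp hq =>
    obtain ⟨T₁, h₁⟩ := hp
    obtain ⟨T₂, h₂⟩ := hq
    exact ⟨T₁ + T₂, by rw [map_add, map_add, map_add, map_add, h₁, h₂]; ring⟩
  | mul_X p i hp =>
    obtain ⟨T, hT⟩ := hp
    by_cases hij : i = j
    · subst hij
      refine ⟨aeval H (pderiv i p) + T * H i + z * T, ?_⟩
      rw [map_mul, map_mul, aeval_X, aeval_X, hT, pderiv_mul, map_add, map_mul, map_mul,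
        pderiv_X, Pi.single_eq_same, map_one, aeval_X, if_pos rfl]
      ring
    · refine ⟨T * H i, ?_⟩
      rw [map_mul, map_mul, aeval_X, aeval_X, hT, pderiv_mul, map_add, map_mul, map_mul,
        pderiv_X, Pi.single_eq_of_ne hij, map_zero, aeval_X, if_neg hij]
      ring

/-- The evaluation `z_0 := w` (other variables fixed) fixes every polynomial not involving `z_0`.
[folklore] -/
private theorem aeval_update_eq_self_of_notMem_vars [DecidableEq W] (z₀ : W) (w : MvPolynomial W K)
    (P : MvPolynomial W K) (hP : z₀ ∉ P.vars) :
    aeval (Function.update X z₀ w) P = P := by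
  have := hom_congr_vars (f₁ := (aeval (Function.update (X : W → MvPolynomial W K) z₀ w)).toRingHom)
    (f₂ := RingHom.id _) (p₁ := P) (p₂ := P) (by ext r; simp) (fun i hi _ => by
      have hne : i ≠ z₀ := fun h => hP (h ▸ hi)
      simp [Function.update_of_ne hne]) rfl
  simpa using this

/-- `f ∘ R` involves only the variables of the `R_j`. [folklore] -/
private theorem notMem_vars_bind₁ [DecidableEq W] (R : Fin n → MvPolynomial W K) (z₀ : W)
    (hR : ∀ j, z₀ ∉ (R j).vars) (q : MvPolynomial (Fin n) K) : z₀ ∉ (bind₁ R q).vars := by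
  intro h
  obtain ⟨j, -, hj⟩ := Finset.mem_biUnion.1 (vars_bind₁ R q h)
  exact hR j hj

/-- **Lemma 3.9, block-free core** ("`∂g/∂z_1 |_{z_1=0} = (∂f/∂x_1) ∘ H ≠ 0` … as `g` is a
projection of `f ∘ (G + H)`, it follows that `f ∘ (G + H) ≠ 0`"): for any polynomial map `R` and a
variable `z_0` occurring in no `R_j`, `(∂_i f) ∘ R ≠ 0 ⇒ f ∘ (R + z_0 e_i) ≠ 0`. No independence,
no blocks; over every field. [cite: MediniShpilka2021, proof of Lemma 3.9 (arXiv p0018:L4-L12)] -/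
theorem bind₁_add_X_ne_zero_of_pderiv [DecidableEq W] (R : Fin n → MvPolynomial W K) (z₀ : W)
    (hR : ∀ j, z₀ ∉ (R j).vars) (f : MvPolynomial (Fin n) K) (i : Fin n)
    (h : bind₁ R (pderiv i f) ≠ 0) :
    bind₁ (fun j => R j + if j = i then X z₀ else 0) f ≠ 0 := by
  intro h0
  obtain ⟨T, hT⟩ := exists_aeval_add_ite_eq R (X z₀) i f
  rw [← aeval_eq_bind₁] at h0
  rw [h0, aeval_eq_bind₁] at hT
  -- evaluate at `z₀ := 0`: the constant term `f ∘ R` vanishes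
  set ζ : MvPolynomial W K →ₐ[K] MvPolynomial W K := aeval (Function.update X z₀ 0) with hζ
  have hζP : ζ (bind₁ R f) = bind₁ R f :=
    aeval_update_eq_self_of_notMem_vars z₀ 0 _ (notMem_vars_bind₁ R z₀ hR f)
  have hζQ : ζ (bind₁ R (pderiv i f)) = bind₁ R (pderiv i f) :=
    aeval_update_eq_self_of_notMem_vars z₀ 0 _ (notMem_vars_bind₁ R z₀ hR _)
  have hζz : ζ (X z₀) = 0 := by rw [hζ, aeval_X, Function.update_self]
  have hP : bind₁ R f = 0 := by
    have e := congr_arg ζ hT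
    rwa [map_zero, map_add, map_add, map_mul, map_mul, map_pow, hζz, hζP, zero_mul,
      zero_pow two_ne_zero, zero_mul, add_zero, add_zero, eq_comm] at e
  rw [hP, zero_add, pow_two, mul_assoc, ← mul_add, eq_comm, mul_eq_zero] at hT
  have h2 : bind₁ R (pderiv i f) + X z₀ * T = 0 := hT.resolve_left (X_ne_zero z₀)
  have e := congr_arg ζ h2
  rw [map_add, map_mul, hζz, hζQ, zero_mul, add_zero, map_zero] at e
  exact h e

/-- **Lemma 3.9, block-free core, directional form**: if `(∂_v f) ∘ R ≠ 0` for
`∂_v = ∑_i v_i ∂_i`, then for SOME `i` with `v_i ≠ 0`, `f ∘ (R + z_0 e_i) ≠ 0` ("there exists some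
`i ∈ [n]` such that `∂f/∂x_i ∘ H ≠ 0`"). [cite: MediniShpilka2021, proof of Lemma 3.9 (arXiv p0018:L4-L6)] -/
theorem exists_bind₁_add_X_ne_zero_of_dirDeriv [DecidableEq W] (R : Fin n → MvPolynomial W K)
    (z₀ : W) (hR : ∀ j, z₀ ∉ (R j).vars) (f : MvPolynomial (Fin n) K) (v : Fin n → K)
    (h : bind₁ R (∑ i, C (v i) * pderiv i f) ≠ 0) :
    ∃ i, v i ≠ 0 ∧ bind₁ (fun j => R j + if j = i then X z₀ else 0) f ≠ 0 := by
  by_contra hcon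
  push Not at hcon
  apply h
  rw [map_sum]
  refine Finset.sum_eq_zero fun i _ => ?_
  rw [map_mul, bind₁_C_right]
  by_cases hv : v i = 0
  · rw [hv, C_0, zero_mul]
  · have := hcon i hv
    by_contra hne
    exact bind₁_add_X_ne_zero_of_pderiv R z₀ hR f i (fun h0 => hne (by rw [h0, mul_zero])) this

/-- **Lemma 3.10, block-free core** (the substitution step of Case 2 of Thm 43: "`f(x + G_1(α,
L(x))) ∘ G_t ≠ 0`, and therefore `f(x + G_1(y_1, z_1)) ∘ G_t ≠ 0`"): for any `R`, a variable `z_0`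
occurring in no `R_j`, and any polynomial `L`, `f(x + L(x) e_i) ∘ R ≠ 0 ⇒ f ∘ (R + z_0 e_i) ≠ 0`
(substitute `z_0 := L(R)`). [cite: MediniShpilka2021, Lemma 3.10 and proof of Thm 43 Case 2 (arXiv p0018:L14-L22, p0035:L1)] -/
theorem bind₁_add_X_ne_zero_of_shift [DecidableEq W] (R : Fin n → MvPolynomial W K) (z₀ : W)
    (hR : ∀ j, z₀ ∉ (R j).vars) (f : MvPolynomial (Fin n) K) (i : Fin n) (L : MvPolynomial (Fin n) K)
    (h : bind₁ R (bind₁ (fun j => X j + if j = i then L else 0) f) ≠ 0) :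
    bind₁ (fun j => R j + if j = i then X z₀ else 0) f ≠ 0 := by
  intro h0
  apply h
  set ζ : MvPolynomial W K →ₐ[K] MvPolynomial W K :=
    aeval (Function.update X z₀ (bind₁ R L)) with hζ
  have hζR : ∀ j, ζ (R j) = R j := fun j => aeval_update_eq_self_of_notMem_vars z₀ _ _ (hR j)
  have hζz : ζ (X z₀) = bind₁ R L := by rw [hζ, aeval_X, Function.update_self]
  have e := congr_arg ζ h0
  rw [map_zero, ← aeval_eq_bind₁, ← AlgHom.comp_apply, comp_aeval] at e
  have hfun : (fun j => ζ (R j + if j = i then X z₀ else 0)) =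
      fun j => bind₁ R (X j + if j = i then L else 0) := by
    funext j
    rw [map_add, hζR, map_add, bind₁_X_right]
    congr 1
    split_ifs
    · exact hζz
    · rw [map_zero, map_zero]
  rw [hfun, ← comp_aeval, AlgHom.comp_apply, aeval_eq_bind₁] at e
  exact e

/-- **Substitution principle**: `f ∘ (ψ ∘ G) ≠ 0 ⇒ f ∘ G ≠ 0` for every `K`-algebra map `ψ`
("As `g` is a projection of `f ∘ (G + H)`, it follows that `f ∘ (G + H) ≠ 0`").
[cite: MediniShpilka2021, proof of Lemma 3.9 (arXiv p0018:L12)] -/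
theorem bind₁_ne_zero_of_bind₁_comp_ne_zero {W' : Type*}
    (ψ : MvPolynomial W' K →ₐ[K] MvPolynomial W K) (G : Fin n → MvPolynomial W' K)
    (f : MvPolynomial (Fin n) K) (h : bind₁ (fun j => ψ (G j)) f ≠ 0) : bind₁ G f ≠ 0 := by
  intro h0
  apply h
  rw [← aeval_eq_bind₁, ← comp_aeval, AlgHom.comp_apply, aeval_eq_bind₁, h0, map_zero]

end Core

/-! ### The pointwise Def-19 clause: one block, one coordinate, any embedding -/

section Pointwise

variable {K : Type*} [Field K] {n c : ℕ} {W : Type*}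

/-- The algebra map "controls of the block `:= a`, the block's `z` `↦ z_0 := ι(z)`, every other
variable fixed" turns `rename ι ∘ G_1 + R` into `R + z_0 · e_i` when `G_1` has the Def-19 clause at
the coordinate `i` with assignment `a` and `R` involves no variable of the block ("there exists
some `α` such that `f ∘ (G + H)|_{y_1 = α} = f(z_1 + H_1, H_2, …, H_n)`").
[cite: MediniShpilka2021, Def 19 and proof of Lemma 3.9 (arXiv p0006:L64-L65, p0018:L4-L6)] -/
theorem aeval_extend_rename_add_eq [DecidableEq W] (ι : Fin c ⊕ Unit → W) (hι : Function.Injective ι)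
    {G₁ : Fin n → MvPolynomial (Fin c ⊕ Unit) K} {i : Fin n} {a : Fin c → K}
    (ha : ∀ j, aeval (Sum.elim (fun s => C (a s)) (fun _ => X ()) :
      Fin c ⊕ Unit → MvPolynomial Unit K) (G₁ j) = if j = i then X () else 0)
    (R : Fin n → MvPolynomial W K) (hR : ∀ j v, ι v ∉ (R j).vars) (j : Fin n) :
    aeval (Function.extend ι (Sum.elim (fun s => C (a s)) (fun _ => X (ι (Sum.inr ()))) :
        Fin c ⊕ Unit → MvPolynomial W K) X) (rename ι (G₁ j) + R j) =
      R j + if j = i then X (ι (Sum.inr ())) else 0 := by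
  rw [map_add, aeval_rename]
  have hcomp : (Function.extend ι (Sum.elim (fun s => C (a s)) (fun _ => X (ι (Sum.inr ()))) :
      Fin c ⊕ Unit → MvPolynomial W K) X ∘ ι) =
      fun v => aeval (fun _ : Unit => (X (ι (Sum.inr ())) : MvPolynomial W K))
        ((Sum.elim (fun s => C (a s)) (fun _ => X ()) : Fin c ⊕ Unit → MvPolynomial Unit K) v) := by
    funext v
    rw [Function.comp_apply, hι.extend_apply]
    rcases v with s | u
    · simp
    · simp
  rw [hcomp, ← comp_aeval, AlgHom.comp_apply, ha j]
  have hRj : aeval (Function.extend ι (Sum.elim (fun s => C (a s)) (fun _ => X (ι (Sum.inr ()))) :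
      Fin c ⊕ Unit → MvPolynomial W K) X) (R j) = R j := by
    have := hom_congr_vars
      (f₁ := (aeval (Function.extend ι (Sum.elim (fun s => C (a s)) (fun _ => X (ι (Sum.inr ()))) :
        Fin c ⊕ Unit → MvPolynomial W K) X)).toRingHom)
      (f₂ := RingHom.id _) (p₁ := R j) (p₂ := R j) (by ext r; simp) (fun w hw _ => by
        have hw' : ¬ ∃ v, ι v = w := fun ⟨v, hv⟩ => hR j v (hv ▸ hw)
        simp [Function.extend_apply' _ _ _ hw']) rfl
    simpa using this
  rw [hRj, add_comm]
  congr 1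
  split_ifs
  · rw [aeval_X]
  · rw [map_zero]

/-- **Lemma 3.9, pointwise**: if the block `G_1` has the Def-19 clause at the coordinate `i` (only
there), `R` is free of the block's variables, and `(∂_i f) ∘ R ≠ 0`, then `f ∘ (G_1 + R) ≠ 0` — for
ANY embedding `ι` of the block's variables. [cite: MediniShpilka2021, Lemma 3.9 (arXiv p0017:L67-p0018:L12)] -/
theorem bind₁_rename_add_ne_zero_of_pderiv [DecidableEq W] (ι : Fin c ⊕ Unit → W)
    (hι : Function.Injective ι) {G₁ : Fin n → MvPolynomial (Fin c ⊕ Unit) K} {i : Fin n}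
    (hi : ∃ a : Fin c → K, ∀ j, aeval (Sum.elim (fun s => C (a s)) (fun _ => X ()) :
      Fin c ⊕ Unit → MvPolynomial Unit K) (G₁ j) = if j = i then X () else 0)
    (R : Fin n → MvPolynomial W K) (hR : ∀ j v, ι v ∉ (R j).vars) (f : MvPolynomial (Fin n) K)
    (h : bind₁ R (pderiv i f) ≠ 0) :
    bind₁ (fun j => rename ι (G₁ j) + R j) f ≠ 0 := by
  obtain ⟨a, ha⟩ := hi
  refine bind₁_ne_zero_of_bind₁_comp_ne_zero (aeval (Function.extend ι
    (Sum.elim (fun s => C (a s)) (fun _ => X (ι (Sum.inr ()))) : Fin c ⊕ Unit → MvPolynomial W K) X))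
    _ f ?_
  have hfun : (fun j => aeval (Function.extend ι (Sum.elim (fun s => C (a s))
      (fun _ => X (ι (Sum.inr ()))) : Fin c ⊕ Unit → MvPolynomial W K) X) (rename ι (G₁ j) + R j)) =
      fun j => R j + if j = i then X (ι (Sum.inr ())) else 0 :=
    funext (aeval_extend_rename_add_eq ι hι ha R hR)
  rw [hfun]
  exact bind₁_add_X_ne_zero_of_pderiv R _ (fun j => hR j _) f i h

/-- **Lemma 3.9, pointwise, directional**: with the Def-19 clause of `G_1` at every coordinate in
the support of `v`, `(∂_v f) ∘ R ≠ 0 ⇒ f ∘ (G_1 + R) ≠ 0`.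
[cite: MediniShpilka2021, Lemma 3.9 and Def 3.6 (arXiv p0017:L44-L49, L67-L73; p0018:L1-L12)] -/
theorem bind₁_rename_add_ne_zero_of_dirDeriv [DecidableEq W] (ι : Fin c ⊕ Unit → W)
    (hι : Function.Injective ι) {G₁ : Fin n → MvPolynomial (Fin c ⊕ Unit) K} (v : Fin n → K)
    (hv : ∀ i, v i ≠ 0 → ∃ a : Fin c → K, ∀ j, aeval (Sum.elim (fun s => C (a s)) (fun _ => X ()) :
      Fin c ⊕ Unit → MvPolynomial Unit K) (G₁ j) = if j = i then X () else 0)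
    (R : Fin n → MvPolynomial W K) (hR : ∀ j w, ι w ∉ (R j).vars) (f : MvPolynomial (Fin n) K)
    (h : bind₁ R (∑ i, C (v i) * pderiv i f) ≠ 0) :
    bind₁ (fun j => rename ι (G₁ j) + R j) f ≠ 0 := by
  -- some `i` with `v_i ≠ 0` and `(∂_i f) ∘ R ≠ 0`
  have : ∃ i, v i ≠ 0 ∧ bind₁ R (pderiv i f) ≠ 0 := by
    by_contra hcon
    push Not at hcon
    apply h
    rw [map_sum]
    refine Finset.sum_eq_zero fun i _ => ?_
    rw [map_mul, bind₁_C_right]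
    by_cases hvi : v i = 0
    · rw [hvi, C_0, zero_mul]
    · rw [hcon i hvi, mul_zero]
  obtain ⟨i, hvi, hi⟩ := this
  exact bind₁_rename_add_ne_zero_of_pderiv ι hι (hv i hvi) R hR f hi

/-- **Lemma 3.10, pointwise**: if the block `G_1` has the Def-19 clause at the coordinate `i`,
`R` is free of the block's variables, and `f(x + L(x) e_i) ∘ R ≠ 0` for some polynomial `L`, then
`f ∘ (G_1 + R) ≠ 0`. [cite: MediniShpilka2021, Lemma 3.10 and proof of Thm 43 Case 2 (arXiv p0018:L14-L34, p0035:L1)] -/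
theorem bind₁_rename_add_ne_zero_of_shift [DecidableEq W] (ι : Fin c ⊕ Unit → W)
    (hι : Function.Injective ι) {G₁ : Fin n → MvPolynomial (Fin c ⊕ Unit) K} {i : Fin n}
    (hi : ∃ a : Fin c → K, ∀ j, aeval (Sum.elim (fun s => C (a s)) (fun _ => X ()) :
      Fin c ⊕ Unit → MvPolynomial Unit K) (G₁ j) = if j = i then X () else 0)
    (R : Fin n → MvPolynomial W K) (hR : ∀ j v, ι v ∉ (R j).vars) (f : MvPolynomial (Fin n) K)
    (L : MvPolynomial (Fin n) K)
    (h : bind₁ R (bind₁ (fun j => X j + if j = i then L else 0) f) ≠ 0) :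
    bind₁ (fun j => rename ι (G₁ j) + R j) f ≠ 0 := by
  obtain ⟨a, ha⟩ := hi
  refine bind₁_ne_zero_of_bind₁_comp_ne_zero (aeval (Function.extend ι
    (Sum.elim (fun s => C (a s)) (fun _ => X (ι (Sum.inr ()))) : Fin c ⊕ Unit → MvPolynomial W K) X))
    _ f ?_
  have hfun : (fun j => aeval (Function.extend ι (Sum.elim (fun s => C (a s))
      (fun _ => X (ι (Sum.inr ()))) : Fin c ⊕ Unit → MvPolynomial W K) X) (rename ι (G₁ j) + R j)) =
      fun j => R j + if j = i then X (ι (Sum.inr ())) else 0 :=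
    funext (aeval_extend_rename_add_eq ι hι ha R hR)
  rw [hfun]
  exact bind₁_add_X_ne_zero_of_shift R _ (fun j => hR j _) f i L h

end Pointwise

/-! ### The sum layout of the toolkit (`G_1 ⊕ H` on `V ⊕ τ`) with the pointwise hypothesis -/

section SumLayout

variable {K : Type*} [Field K] {n c : ℕ} {τ : Type*}

/-- `H` renamed into the right summand involves no variable of the left summand. [folklore] -/
private theorem inl_notMem_vars_rename_inr [DecidableEq τ] (H : Fin n → MvPolynomial τ K) (j : Fin n)
    (v : Fin c ⊕ Unit) : (Sum.inl v : (Fin c ⊕ Unit) ⊕ τ) ∉ (rename Sum.inr (H j)).vars := by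
  classical
  intro h
  obtain ⟨w, -, hw⟩ := Finset.mem_image.1 (vars_rename _ _ h)
  exact Sum.inr_ne_inl hw

/-- `q ∘ (rename inr ∘ H) = rename inr (q ∘ H)`. [folklore] -/
private theorem bind₁_rename_inr_comp (H : Fin n → MvPolynomial τ K) (q : MvPolynomial (Fin n) K) :
    bind₁ (fun j => rename (Sum.inr : τ → (Fin c ⊕ Unit) ⊕ τ) (H j)) q = rename Sum.inr (bind₁ H q) := by
  rw [← aeval_eq_bind₁, ← aeval_eq_bind₁, ← AlgHom.comp_apply, comp_aeval]

/-- **Lemma 3.9 (`k = 1`) of the toolkit with the POINTWISE hypothesis**: the statement of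
`MS2021.bind₁_sum_ne_zero_of_pderiv` with `IsOneIndependent G₁` weakened to the Def-19 clause at
the differentiated coordinate `i` alone. [cite: MediniShpilka2021, Lemma 3.9 (arXiv p0017:L67-p0018:L12)] -/
theorem bind₁_sum_ne_zero_of_pderiv_pointwise {G₁ : Fin n → MvPolynomial (Fin c ⊕ Unit) K}
    {i : Fin n} (hi : ∃ a : Fin c → K, ∀ j, aeval (Sum.elim (fun s => C (a s)) (fun _ => X ()) :
      Fin c ⊕ Unit → MvPolynomial Unit K) (G₁ j) = if j = i then X () else 0)
    (H : Fin n → MvPolynomial τ K) (f : MvPolynomial (Fin n) K) (h : bind₁ H (pderiv i f) ≠ 0) :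
    bind₁ (fun j => rename Sum.inl (G₁ j) + rename Sum.inr (H j)) f ≠ 0 := by
  classical
  refine bind₁_rename_add_ne_zero_of_pderiv Sum.inl Sum.inl_injective hi _
    (fun j v => inl_notMem_vars_rename_inr H j v) f ?_
  rw [bind₁_rename_inr_comp]
  exact (map_ne_zero_iff _ (rename_injective _ Sum.inr_injective)).2 h

/-- **Lemma 3.9 (`k = 1`), directional, POINTWISE on `supp v`.**
[cite: MediniShpilka2021, Lemma 3.9 and Def 3.6 (arXiv p0017:L44-L49, L67-L73; p0018:L1-L12)] -/
theorem bind₁_sum_ne_zero_of_dirDeriv_pointwise {G₁ : Fin n → MvPolynomial (Fin c ⊕ Unit) K}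
    (v : Fin n → K) (hv : ∀ i, v i ≠ 0 → ∃ a : Fin c → K, ∀ j,
      aeval (Sum.elim (fun s => C (a s)) (fun _ => X ()) :
        Fin c ⊕ Unit → MvPolynomial Unit K) (G₁ j) = if j = i then X () else 0)
    (H : Fin n → MvPolynomial τ K) (f : MvPolynomial (Fin n) K)
    (h : bind₁ H (∑ i, C (v i) * pderiv i f) ≠ 0) :
    bind₁ (fun j => rename Sum.inl (G₁ j) + rename Sum.inr (H j)) f ≠ 0 := by
  classical
  refine bind₁_rename_add_ne_zero_of_dirDeriv Sum.inl Sum.inl_injective v hv _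
    (fun j w => inl_notMem_vars_rename_inr H j w) f ?_
  rw [bind₁_rename_inr_comp]
  exact (map_ne_zero_iff _ (rename_injective _ Sum.inr_injective)).2 h

/-- **Lemma 3.10 (`k = 1`) of the toolkit with the POINTWISE hypothesis**: the statement of
`MS2021.bind₁_sum_ne_zero_of_shift` with `IsOneIndependent G₁` weakened to the Def-19 clause at the
shifted coordinate `i` alone. [cite: MediniShpilka2021, Lemma 3.10 (arXiv p0018:L14-L34)] -/
theorem bind₁_sum_ne_zero_of_shift_pointwise {G₁ : Fin n → MvPolynomial (Fin c ⊕ Unit) K}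
    {i : Fin n} (hi : ∃ a : Fin c → K, ∀ j, aeval (Sum.elim (fun s => C (a s)) (fun _ => X ()) :
      Fin c ⊕ Unit → MvPolynomial Unit K) (G₁ j) = if j = i then X () else 0)
    (H : Fin n → MvPolynomial τ K) (f : MvPolynomial (Fin n) K) (L : MvPolynomial (Fin n) K)
    (h : bind₁ H (bind₁ (fun j => X j + if j = i then L else 0) f) ≠ 0) :
    bind₁ (fun j => rename Sum.inl (G₁ j) + rename Sum.inr (H j)) f ≠ 0 := by
  classical
  refine bind₁_rename_add_ne_zero_of_shift Sum.inl Sum.inl_injective hi _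
    (fun j v => inl_notMem_vars_rename_inr H j v) f L ?_
  rw [bind₁_rename_inr_comp]
  exact (map_ne_zero_iff _ (rename_injective _ Sum.inr_injective)).2 h

end SumLayout

/-! ### The inert layout `G⁺ = (G, u^e)` of the B34 repair: peeling one block -/

section InertLayout

variable {K : Type*} [Field K] {n c k : ℕ}

/-- Peeling block `0` off the inert extension of a peeled map `G = G_1 + G'`:
`G⁺ = rename(block 0) ∘ (G_1, 0) + R` with `R = (G'-part, u^e)`.
[cite: MediniShpilka2021, Def 19 and proof of Thm 35 (arXiv p0006:L65, p0030:L30)] -/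
theorem inert_peel_eq (e : ℕ) (G₁ : Fin n → MvPolynomial (Fin c ⊕ Unit) K)
    (G' : Fin n → MvPolynomial (Fin k × (Fin c ⊕ Unit)) K) (j : Fin (n + 1)) :
    Fin.lastCases (motive := fun _ => MvPolynomial ((Fin (k + 1) × (Fin c ⊕ Unit)) ⊕ Unit) K)
        (X (Sum.inr ()) ^ e)
        (fun j => rename Sum.inl (rename (Prod.mk 0) (G₁ j) + rename (Prod.map Fin.succ id) (G' j))) j =
      rename (Sum.inl ∘ Prod.mk (0 : Fin (k + 1)))
          (Fin.lastCases (motive := fun _ => MvPolynomial (Fin c ⊕ Unit) K) 0 G₁ j) +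
        Fin.lastCases (motive := fun _ => MvPolynomial ((Fin (k + 1) × (Fin c ⊕ Unit)) ⊕ Unit) K)
          (X (Sum.inr ()) ^ e) (fun j => rename (Sum.inl ∘ Prod.map Fin.succ id) (G' j)) j := by
  refine Fin.lastCases ?_ (fun j => ?_) j
  · simp only [Fin.lastCases_last, map_zero, zero_add]
  · simp only [Fin.lastCases_castSucc, map_add, rename_rename]

/-- The Def-19 clause of `G_1` at `i` gives the clause of the padded block `(G_1, 0)` at
`castSucc i` (and at no `Fin.last`: the inert coordinate is reached by no block).
[cite: MediniShpilka2021, Def 19 (arXiv p0006:L64-L65)] -/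
theorem pointwise_lastCases_zero {G₁ : Fin n → MvPolynomial (Fin c ⊕ Unit) K} {i : Fin n}
    (hi : ∃ a : Fin c → K, ∀ j, aeval (Sum.elim (fun s => C (a s)) (fun _ => X ()) :
      Fin c ⊕ Unit → MvPolynomial Unit K) (G₁ j) = if j = i then X () else 0) :
    ∃ a : Fin c → K, ∀ j : Fin (n + 1), aeval (Sum.elim (fun s => C (a s)) (fun _ => X ()) :
      Fin c ⊕ Unit → MvPolynomial Unit K)
        (Fin.lastCases (motive := fun _ => MvPolynomial (Fin c ⊕ Unit) K) 0 G₁ j) =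
      if j = Fin.castSucc i then X () else 0 := by
  obtain ⟨a, ha⟩ := hi
  refine ⟨a, fun j => Fin.lastCases ?_ (fun j => ?_) j⟩
  · rw [Fin.lastCases_last, map_zero, if_neg (Fin.castSucc_lt_last i).ne']
  · rw [Fin.lastCases_castSucc, ha j]
    simp only [Fin.castSucc_inj]

/-- The rest `R = (G'-part, u^e)` involves no variable of block `0`. [folklore] -/
private theorem inl_zero_notMem_vars_rest (e : ℕ) (G' : Fin n → MvPolynomial (Fin k × (Fin c ⊕ Unit)) K)
    (j : Fin (n + 1)) (v : Fin c ⊕ Unit) :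
    (Sum.inl (((0 : Fin (k + 1)), v)) : (Fin (k + 1) × (Fin c ⊕ Unit)) ⊕ Unit) ∉
      (Fin.lastCases (motive := fun _ => MvPolynomial ((Fin (k + 1) × (Fin c ⊕ Unit)) ⊕ Unit) K)
        (X (Sum.inr ()) ^ e) (fun j => rename (Sum.inl ∘ Prod.map Fin.succ id) (G' j)) j).vars := by
  classical
  refine Fin.lastCases ?_ (fun j => ?_) j
  · rw [Fin.lastCases_last]
    intro h
    have := vars_pow (X (Sum.inr ()) : MvPolynomial ((Fin (k + 1) × (Fin c ⊕ Unit)) ⊕ Unit) K) e h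
    rw [vars_X, Finset.mem_singleton] at this
    exact Sum.inl_ne_inr this
  · rw [Fin.lastCases_castSucc]
    intro h
    obtain ⟨w, -, hw⟩ := Finset.mem_image.1 (vars_rename _ _ h)
    simp only [Function.comp_apply, Sum.inl.injEq, Prod.map, Prod.mk.injEq, id_eq] at hw
    exact Fin.succ_ne_zero _ hw.1

/-- The rest `R` is the inert extension of `G'`, renamed along `(l, v) ↦ (l+1, v)`. [folklore] -/
private theorem rest_eq_rename (e : ℕ) (G' : Fin n → MvPolynomial (Fin k × (Fin c ⊕ Unit)) K)
    (j : Fin (n + 1)) :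
    Fin.lastCases (motive := fun _ => MvPolynomial ((Fin (k + 1) × (Fin c ⊕ Unit)) ⊕ Unit) K)
        (X (Sum.inr ()) ^ e) (fun j => rename (Sum.inl ∘ Prod.map Fin.succ id) (G' j)) j =
      rename (Sum.map (Prod.map Fin.succ id) id)
        (Fin.lastCases (motive := fun _ => MvPolynomial ((Fin k × (Fin c ⊕ Unit)) ⊕ Unit) K)
          (X (Sum.inr ()) ^ e) (fun j => rename Sum.inl (G' j)) j) := by
  refine Fin.lastCases ?_ (fun j => ?_) j
  · simp only [Fin.lastCases_last, map_pow, rename_X, Sum.map_inr, id_eq]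
  · simp only [Fin.lastCases_castSucc, rename_rename]
    rfl

/-- **Peeling in the inert layout, Lemma 3.9 form**: for `G = G_1 + G'` with the Def-19 clause of
`G_1` at `i`, and `h` a polynomial in `x_0, …, x_n` (e.g. a homogenisation): if
`(∂_{castSucc i} h) ∘ G'⁺ ≠ 0` then `h ∘ G⁺ ≠ 0`, where `(·)⁺` is the inert extension by `u^e`.
[cite: MediniShpilka2021, Lemma 3.9 (arXiv p0017:L67-p0018:L12) and proof of Thm 35 (p0030:L30)] -/
theorem bind₁_inert_ne_zero_of_pderiv (e : ℕ) {G₁ : Fin n → MvPolynomial (Fin c ⊕ Unit) K}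
    {i : Fin n} (hi : ∃ a : Fin c → K, ∀ j, aeval (Sum.elim (fun s => C (a s)) (fun _ => X ()) :
      Fin c ⊕ Unit → MvPolynomial Unit K) (G₁ j) = if j = i then X () else 0)
    (G' : Fin n → MvPolynomial (Fin k × (Fin c ⊕ Unit)) K) (h : MvPolynomial (Fin (n + 1)) K)
    (hne : bind₁ (Fin.lastCases (motive := fun _ => MvPolynomial ((Fin k × (Fin c ⊕ Unit)) ⊕ Unit) K)
      (X (Sum.inr ()) ^ e) (fun j => rename Sum.inl (G' j))) (pderiv (Fin.castSucc i) h) ≠ 0) :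
    bind₁ (Fin.lastCases (motive := fun _ => MvPolynomial ((Fin (k + 1) × (Fin c ⊕ Unit)) ⊕ Unit) K)
      (X (Sum.inr ()) ^ e)
      (fun j => rename Sum.inl (rename (Prod.mk 0) (G₁ j) + rename (Prod.map Fin.succ id) (G' j)))) h
      ≠ 0 := by
  classical
  have hfun := funext (inert_peel_eq e G₁ G')
  rw [hfun]
  refine bind₁_rename_add_ne_zero_of_pderiv _ (Sum.inl_injective.comp (Prod.mk_right_injective 0))
    (pointwise_lastCases_zero hi) _ (fun j v => inl_zero_notMem_vars_rest e G' j v) h ?_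
  rw [funext (rest_eq_rename e G'), ← aeval_eq_bind₁, ← comp_aeval, AlgHom.comp_apply,
    aeval_eq_bind₁]
  exact (map_ne_zero_iff _ (rename_injective _
    ((Fin.succ_injective k).prodMap Function.injective_id |>.sumMap Function.injective_id))).2 hne

/-- **Peeling in the inert layout, directional form** (Def-19 clauses of `G_1` on `supp v`, `v`
supported on the first `n` coordinates). [cite: MediniShpilka2021, Lemma 3.9, Def 3.6 (arXiv p0017:L44-L49, L67-p0018:L12)] -/
theorem bind₁_inert_ne_zero_of_dirDeriv (e : ℕ) {G₁ : Fin n → MvPolynomial (Fin c ⊕ Unit) K}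
    (v : Fin n → K) (hv : ∀ i, v i ≠ 0 → ∃ a : Fin c → K, ∀ j,
      aeval (Sum.elim (fun s => C (a s)) (fun _ => X ()) :
        Fin c ⊕ Unit → MvPolynomial Unit K) (G₁ j) = if j = i then X () else 0)
    (G' : Fin n → MvPolynomial (Fin k × (Fin c ⊕ Unit)) K) (h : MvPolynomial (Fin (n + 1)) K)
    (hne : bind₁ (Fin.lastCases (motive := fun _ => MvPolynomial ((Fin k × (Fin c ⊕ Unit)) ⊕ Unit) K)
      (X (Sum.inr ()) ^ e) (fun j => rename Sum.inl (G' j)))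
        (∑ i, C (v i) * pderiv (Fin.castSucc i) h) ≠ 0) :
    bind₁ (Fin.lastCases (motive := fun _ => MvPolynomial ((Fin (k + 1) × (Fin c ⊕ Unit)) ⊕ Unit) K)
      (X (Sum.inr ()) ^ e)
      (fun j => rename Sum.inl (rename (Prod.mk 0) (G₁ j) + rename (Prod.map Fin.succ id) (G' j)))) h
      ≠ 0 := by
  -- some `i` with `v_i ≠ 0` and `(∂_{castSucc i} h) ∘ G'⁺ ≠ 0`
  have : ∃ i, v i ≠ 0 ∧ bind₁ (Fin.lastCases
      (motive := fun _ => MvPolynomial ((Fin k × (Fin c ⊕ Unit)) ⊕ Unit) K)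
      (X (Sum.inr ()) ^ e) (fun j => rename Sum.inl (G' j))) (pderiv (Fin.castSucc i) h) ≠ 0 := by
    by_contra hcon
    push Not at hcon
    apply hne
    rw [map_sum]
    refine Finset.sum_eq_zero fun i _ => ?_
    rw [map_mul, bind₁_C_right]
    by_cases hvi : v i = 0
    · rw [hvi, C_0, zero_mul]
    · rw [hcon i hvi, mul_zero]
  obtain ⟨i, hvi, hi⟩ := this
  exact bind₁_inert_ne_zero_of_pderiv e (hv i hvi) G' h hi

/-- **Peeling in the inert layout, Lemma 3.10 form**: if `h(x̃ + L(x̃) e_{castSucc i}) ∘ G'⁺ ≠ 0`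
for some polynomial `L` then `h ∘ G⁺ ≠ 0`.
[cite: MediniShpilka2021, Lemma 3.10 (arXiv p0018:L14-L34) and proof of Thm 35 (p0030:L30)] -/
theorem bind₁_inert_ne_zero_of_shift (e : ℕ) {G₁ : Fin n → MvPolynomial (Fin c ⊕ Unit) K}
    {i : Fin n} (hi : ∃ a : Fin c → K, ∀ j, aeval (Sum.elim (fun s => C (a s)) (fun _ => X ()) :
      Fin c ⊕ Unit → MvPolynomial Unit K) (G₁ j) = if j = i then X () else 0)
    (G' : Fin n → MvPolynomial (Fin k × (Fin c ⊕ Unit)) K) (h : MvPolynomial (Fin (n + 1)) K)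
    (L : MvPolynomial (Fin (n + 1)) K)
    (hne : bind₁ (Fin.lastCases (motive := fun _ => MvPolynomial ((Fin k × (Fin c ⊕ Unit)) ⊕ Unit) K)
      (X (Sum.inr ()) ^ e) (fun j => rename Sum.inl (G' j)))
        (bind₁ (fun j => X j + if j = Fin.castSucc i then L else 0) h) ≠ 0) :
    bind₁ (Fin.lastCases (motive := fun _ => MvPolynomial ((Fin (k + 1) × (Fin c ⊕ Unit)) ⊕ Unit) K)
      (X (Sum.inr ()) ^ e)
      (fun j => rename Sum.inl (rename (Prod.mk 0) (G₁ j) + rename (Prod.map Fin.succ id) (G' j)))) h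
      ≠ 0 := by
  classical
  have hfun := funext (inert_peel_eq e G₁ G')
  rw [hfun]
  refine bind₁_rename_add_ne_zero_of_shift _ (Sum.inl_injective.comp (Prod.mk_right_injective 0))
    (pointwise_lastCases_zero hi) _ (fun j v => inl_zero_notMem_vars_rest e G' j v) h L ?_
  rw [funext (rest_eq_rename e G'), ← aeval_eq_bind₁, ← comp_aeval, AlgHom.comp_apply,
    aeval_eq_bind₁]
  exact (map_ne_zero_iff _ (rename_injective _
    ((Fin.succ_injective k).prodMap Function.injective_id |>.sumMap Function.injective_id))).2 hne

end InertLayout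

end MS2021

end Literature.Computability.AlgebraicComplexity

end
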